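import Summits.ABC.StewartYu.PadicG3ExitBPrep
import HarnessLib

/-!
# Cell abc-stewartyu, Gen-3 record (WP-M3.R): magnitudes for clause (C) of the record under the
# instantiation convention — the Matveev box `Λ = ρ + Amax`, `yload ≤ 11 G`, `L ≤ (264 Cbⁿ + 2^{2n+26}) K Ω`

`Summits/ABC/StewartYu/PadicG3ExitCPrep.lean` — cell `abc-stewartyu` (HOME `run/shared/lean/pub/abc-stewartyu/`),
route `PadicPrimesKummerThird`, cruxes `Y07Odd` (stmt-ABC-19658) / `Y07Two` (stmt-ABC-19659); seat lp-1 (g2),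
record parcel (R3) preparation.  Theorems only.

Clause (C) of `RecordAssembly.recordTwo_of_ineqs` / `recordOdd_of_ineqs` (the (5.22) cost line with p4's
`Pmax`) needs a Matveev box constant `Λ` with `Dⱼ·Aⱼ ≤ Λ` and upper bounds for `Λ` and `L` in terms of
`Ω = ∏ Aⱼ`.  Under the RULED instantiation convention (plan g8 2026-08-27T01:00:18Z: `K ≤ N_q ≤ 2ⁿK`,
`½ ≤ θ₀`, `Amax ≤ 2ⁿΩ`; and `Aⱼ ≥ 1`, the frames' height floor) this file proves:

* `D_mul_A_le` — `Dⱼ·Aⱼ ≤ ρ + Amax` (`ρ = N_q L/2^Ŝ`): the box constant `Λ := ρ + Amax`;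
* `rho_add_Amax_le` — `ρ + Amax ≤ (2^{−(n+23)} + 2ⁿ/(24·Cbⁿ))·L` (`Amax ≤ 2ⁿΩ`, `24 Cbⁿ Ω K ≤ L`);
* `log_p_le`, `log_K_le`, `log_Nq_le`, `yload_le_eleven_G` — `log p ≤ 2G`, `log K ≤ 2G`, `log N_q ≤ n log 2 + 2G`,
  hence **`yload ≤ 11·G`** (the `(Ŝ+n+1)·log 2` term of `yload` is where `log₂ N_q` enters);
* `L_le_KΩ` — **`L ≤ (264·Cbⁿ + 2^{2n+26})·K·Ω`** (the three branches of `L`: Siegel term with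
  `yload/G ≤ 11`, `2^{n+25}N_q ≤ 2^{2n+25}K`, `⌈2Amax⌉ ≤ 2^{n+1}Ω + 1`).

With these, `Pmax(r, d₀)/Ω ≲ c(n,r)·(Λ/L)ʳ·(L/(KΩ))/2^{n+22}` is a function of `n, r` alone, and clause (C)
reduces to a two-parameter constant comparison against the growth `C n ≥ 256^{n−r}·C r` of the admissible
constant (STATUS lp-1 2026-08-27T02:1xZ) — the sequel `PadicG3ExitC.lean`.

WHAT THIS IS NOT: no crux moves; clause (C) itself is the sequel.

References: Yu. V. Nesterenko, LNM 1819 (2003), §5.2 (5.19)–(5.22); K. Yu, Acta Arith. 89 (1999), §10.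
-/

noncomputable section

open Finset Real

namespace Summit.ABC.StewartYu

namespace PadicG3Par

variable {n : ℕ} (P : PadicG3Par n)

/-! ### The Matveev box `Λ = ρ + Amax` -/

/-- **`Dⱼ·Aⱼ ≤ ρ + Amax`** (`Dⱼ ≤ ρ/Aⱼ + 1`): hypothesis `hΛ` of `RecordAssembly.recordTwo_of_ineqs` with
`Λ := N_q L/2^Ŝ + Amax`, `V := A`. [cite: Nesterenko2003, §5.2 (5.21)] -/
theorem D_mul_A_le (j : Fin n) :
    (P.D j : ℝ) * P.A j ≤ (P.Nq : ℝ) * P.L / 2 ^ P.Sdepth + P.Amax := by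
  have hA := P.A_pos j
  have h := P.D_le_rho_div j
  have hAmax := P.hAmax j
  have h1 : (P.D j : ℝ) * P.A j ≤ ((P.Nq : ℝ) * P.L / 2 ^ P.Sdepth / P.A j + 1) * P.A j :=
    mul_le_mul_of_nonneg_right h hA.le
  have e : ((P.Nq : ℝ) * P.L / 2 ^ P.Sdepth / P.A j + 1) * P.A j =
      (P.Nq : ℝ) * P.L / 2 ^ P.Sdepth + P.A j := by field_simp
  linarith [h1, e.le]

/-- `64 ≤ Cb` (`Cb = 32e`). [folklore] -/
theorem sixtyfour_le_Cb : (64 : ℝ) ≤ Cb := by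
  unfold Cb cM; have := Real.add_one_le_exp (1 : ℝ); push_cast; nlinarith

/-- **`ρ + Amax ≤ (2^{−(n+23)} + 2ⁿ/(24 Cbⁿ))·L`** under `Amax ≤ 2ⁿΩ` (and `24 Cbⁿ Ω K ≤ L`, `K ≥ 1`).
[cite: Nesterenko2003, §5.2 (5.21)] -/
theorem rho_add_Amax_le (hAmax : P.Amax ≤ 2 ^ n * P.Ω) :
    (P.Nq : ℝ) * P.L / 2 ^ P.Sdepth + P.Amax ≤ ((2 : ℝ) ^ (n + 23))⁻¹ * P.L + 2 ^ n / (24 * Cb ^ n) * P.L := by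
  have hρ := P.rho_lt
  have hmain := P.main_le_L'
  have hK : (1 : ℝ) ≤ P.K := by exact_mod_cast P.one_le_K
  have hΩ := P.Ω_pos
  have hCb : (0 : ℝ) < Cb ^ n := by have := sixtyfour_le_Cb; positivity
  have h1 : (P.Nq : ℝ) * P.L / 2 ^ P.Sdepth ≤ ((2 : ℝ) ^ (n + 23))⁻¹ * P.L := by
    rw [inv_mul_eq_div]; exact hρ.le
  -- `Ω ≤ L/(24 Cbⁿ K) ≤ L/(24 Cbⁿ)`
  have h2 : P.Ω * (24 * Cb ^ n) ≤ P.L := by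
    calc P.Ω * (24 * Cb ^ n) = 24 * Cb ^ n * P.Ω * 1 := by ring
      _ ≤ 24 * Cb ^ n * P.Ω * P.K := mul_le_mul_of_nonneg_left hK (by positivity)
      _ ≤ P.L := hmain
  have h3 : P.Amax ≤ 2 ^ n / (24 * Cb ^ n) * P.L := by
    rw [div_mul_eq_mul_div, le_div_iff₀ (by positivity)]
    calc P.Amax * (24 * Cb ^ n) ≤ 2 ^ n * P.Ω * (24 * Cb ^ n) :=
          mul_le_mul_of_nonneg_right hAmax (by positivity)
      _ = 2 ^ n * (P.Ω * (24 * Cb ^ n)) := by ring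
      _ ≤ 2 ^ n * P.L := mul_le_mul_of_nonneg_left h2 (by positivity)
  linarith

/-! ### Logarithmic sizes: `log p`, `log K`, `log N_q`, `yload` -/

/-- `log p ≤ 2 G` under `½ ≤ θ₀` (`θ₀ log p ≤ G`). [folklore] -/
theorem log_p_le (hθ : (1 / 2 : ℝ) ≤ P.θ₀) : Real.log P.p ≤ 2 * P.G := by
  have h := P.θ₀_log_le_G
  have hl := P.log_p_pos
  nlinarith

/-- `log K ≤ 2 G` under `½ ≤ θ₀` (`K = p^m K₀ ≤ p^{m+1}`, `(m+1) log p = G + (1−θ₀) log p`).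
[cite: Yu1999, §10 (10.16)] -/
theorem log_K_le (hθ : (1 / 2 : ℝ) ≤ P.θ₀) : Real.log P.K ≤ 2 * P.G := by
  have hp : (1 : ℝ) < P.p := by linarith [P.two_le_p]
  have hp0 : (0 : ℝ) < P.p := by linarith
  have hl := P.log_p_pos
  have hK₀ : (P.K₀ : ℝ) ≤ P.p := by exact_mod_cast P.hK₀p
  have hK₀1 : (1 : ℝ) ≤ P.K₀ := by exact_mod_cast P.hK₀
  -- `K ≤ p^{m+1}`
  have hK : (P.K : ℝ) ≤ (P.p : ℝ) ^ (P.m + 1) := by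
    unfold K; push_cast
    rw [pow_succ]
    exact mul_le_mul_of_nonneg_left hK₀ (by positivity)
  have hKpos : (0 : ℝ) < P.K := P.K_pos
  have h1 : Real.log P.K ≤ (P.m + 1) * Real.log P.p := by
    have := Real.log_le_log hKpos hK
    rwa [Real.log_pow, Nat.cast_add, Nat.cast_one] at this
  -- `(m+1) log p = G + (1 - θ₀) log p ≤ G + log p / 2 ≤ 2G`
  have hG : P.G = (P.m + P.θ₀) * Real.log P.p := by unfold G θm; ring
  have hθ2 := P.hθ₀2
  have h2 : ((P.m : ℝ) + 1) * Real.log P.p ≤ 2 * P.G := by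
    rw [hG]; nlinarith
  linarith

/-- `log N_q ≤ n log 2 + 2 G` under `N_q ≤ 2ⁿ K`, `½ ≤ θ₀`. [folklore] -/
theorem log_Nq_le (hθ : (1 / 2 : ℝ) ≤ P.θ₀) (hNqK : P.Nq ≤ 2 ^ n * P.K) :
    Real.log P.Nq ≤ n * Real.log 2 + 2 * P.G := by
  have hNq : (0 : ℝ) < P.Nq := by exact_mod_cast P.hNq
  have h1 : (P.Nq : ℝ) ≤ 2 ^ n * P.K := by exact_mod_cast hNqK
  have h2 := Real.log_le_log hNq h1
  rw [Real.log_mul (by positivity) P.K_pos.ne', Real.log_pow] at h2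
  linarith [P.log_K_le hθ]

/-- `(log₂ N_q) · log 2 ≤ log N_q` (`2^{⌊log₂ N_q⌋} ≤ N_q`). [folklore] -/
theorem natlog_mul_log_two_le : (Nat.log 2 P.Nq : ℝ) * Real.log 2 ≤ Real.log P.Nq := by
  have hNq : P.Nq ≠ 0 := by have := P.hNq; omega
  have h : (2 : ℝ) ^ Nat.log 2 P.Nq ≤ P.Nq := by exact_mod_cast Nat.pow_log_le_self 2 hNq
  have := Real.log_le_log (by positivity) h
  rwa [Real.log_pow] at this

/-- **`yload ≤ 11 · G`** under `½ ≤ θ₀`, `N_q ≤ 2ⁿK`: `yload = G + 2 log p + (Ŝ+n+1) log 2 + log(n+1) + 8`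
with `log p ≤ 2G`, `(Ŝ+n+1) log 2 ≤ (3n+25) log 2 + 2G ≤ 4.2 G`, `log(n+1) + 8 ≤ G`. [folklore] -/
theorem yload_le_eleven_G (hθ : (1 / 2 : ℝ) ≤ P.θ₀) (hNqK : P.Nq ≤ 2 ^ n * P.K) : P.yload ≤ 11 * P.G := by
  have hG8 := P.cG_mul_le_G
  unfold cG at hG8
  have hlogp := P.log_p_le hθ
  have hNq := P.log_Nq_le hθ hNqK
  have hnat := P.natlog_mul_log_two_le
  have hlog2 : Real.log 2 < 0.6931471808 := Real.log_two_lt_d9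
  have hlog2' : 0 < Real.log 2 := by have := Real.log_two_gt_d9; linarith
  have hn : (0 : ℝ) ≤ n := by positivity
  have hlogn : Real.log ((n : ℝ) + 1) ≤ n := by
    have := Real.log_le_sub_one_of_pos (show (0 : ℝ) < n + 1 by positivity); linarith
  unfold yload Sdepth
  push_cast
  -- `(n + 24 + log₂ Nq + n + 1) · log 2 ≤ (2n+25) log 2 + log Nq ≤ (3n+25) log 2 + 2G`
  have h1 : ((n : ℝ) + 24 + (Nat.log 2 P.Nq : ℝ) + n + 1) * Real.log 2 ≤
      (3 * n + 25) * Real.log 2 + 2 * P.G := by nlinarith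
  nlinarith

/-! ### `L ≤ (264 Cbⁿ + 2^{2n+26}) · K · Ω` -/

/-- **`L ≤ (264·Cbⁿ + 2^{2n+26})·K·Ω`** under the convention facts (`½ ≤ θ₀`, `N_q ≤ 2ⁿK`, `Amax ≤ 2ⁿΩ`)
and the height floor `Aⱼ ≥ 1`: the three branches `⌈24 Cbⁿ Ω K·yload/G⌉ ≤ 264 Cbⁿ Ω K + 1`,
`2^{n+25} N_q ≤ 2^{2n+25} K`, `⌈2Amax⌉ ≤ 2^{n+1} Ω + 1`. [cite: Nesterenko2003, §3.5 (3.23)] -/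
theorem L_le_KΩ (hθ : (1 / 2 : ℝ) ≤ P.θ₀) (hNqK : P.Nq ≤ 2 ^ n * P.K) (hAmax : P.Amax ≤ 2 ^ n * P.Ω)
    (hA1 : ∀ j, 1 ≤ P.A j) :
    (P.L : ℝ) ≤ (264 * Cb ^ n + 2 ^ (2 * n + 26)) * P.K * P.Ω := by
  have hG : 0 < P.G := by linarith [P.eight_le_G]
  have hy := P.yload_le_eleven_G hθ hNqK
  have hK1 : (1 : ℝ) ≤ P.K := by exact_mod_cast P.one_le_K
  have hΩ1 : (1 : ℝ) ≤ P.Ω := by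
    unfold Ω
    calc (1 : ℝ) = ∏ _j : Fin n, (1 : ℝ) := by simp
      _ ≤ ∏ j, P.A j := prod_le_prod (fun _ _ => zero_le_one) fun j _ => hA1 j
  have hCb : (0 : ℝ) < Cb ^ n := by have := sixtyfour_le_Cb; positivity
  have hΩ := P.Ω_pos
  have hKpos := P.K_pos
  -- the three branches
  set a : ℝ := 24 * Cb ^ n * P.Ω * P.K * P.yload / P.G with ha
  have ha0 : 0 ≤ a := by
    have : 0 ≤ P.yload := le_trans hG.le P.G_le_yload
    positivity
  have ha1 : a ≤ 264 * Cb ^ n * P.Ω * P.K := by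
    rw [ha, div_le_iff₀ hG]
    calc 24 * Cb ^ n * P.Ω * P.K * P.yload ≤ 24 * Cb ^ n * P.Ω * P.K * (11 * P.G) :=
          mul_le_mul_of_nonneg_left hy (by positivity)
      _ = 264 * Cb ^ n * P.Ω * P.K * P.G := by ring
  have hNq : (P.Nq : ℝ) ≤ 2 ^ n * P.K := by exact_mod_cast hNqK
  have hAmax0 : 0 ≤ P.Amax := by linarith [P.hAmax1]
  have hL : (P.L : ℝ) = max (max (⌈a⌉₊ : ℝ) ((2 : ℝ) ^ (n + 25) * P.Nq)) (⌈2 * P.Amax⌉₊ : ℝ) := by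
    unfold L; rw [ha]; push_cast; rfl
  rw [hL]
  have hc1 : (⌈a⌉₊ : ℝ) ≤ a + 1 := (Nat.ceil_lt_add_one ha0).le
  have hc2 : (⌈2 * P.Amax⌉₊ : ℝ) ≤ 2 * P.Amax + 1 := (Nat.ceil_lt_add_one (by positivity)).le
  have hb : (2 : ℝ) ^ (n + 25) * P.Nq ≤ 2 ^ (2 * n + 25) * P.K * P.Ω := by
    calc (2 : ℝ) ^ (n + 25) * P.Nq ≤ 2 ^ (n + 25) * (2 ^ n * P.K) :=
          mul_le_mul_of_nonneg_left hNq (by positivity)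
      _ = 2 ^ (2 * n + 25) * P.K * 1 := by rw [two_mul, pow_add, pow_add]; ring
      _ ≤ 2 ^ (2 * n + 25) * P.K * P.Ω := mul_le_mul_of_nonneg_left hΩ1 (by positivity)
  have hc : 2 * P.Amax + 1 ≤ (2 ^ (n + 1) + 1) * P.K * P.Ω := by
    have h1 : 2 * P.Amax ≤ 2 ^ (n + 1) * P.K * P.Ω := by
      calc 2 * P.Amax ≤ 2 * (2 ^ n * P.Ω) := by linarith
        _ = 2 ^ (n + 1) * 1 * P.Ω := by rw [pow_succ]; ring
        _ ≤ 2 ^ (n + 1) * P.K * P.Ω :=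
            mul_le_mul_of_nonneg_right (mul_le_mul_of_nonneg_left hK1 (by positivity)) hΩ.le
    have h2 : (1 : ℝ) ≤ 1 * P.K * P.Ω := by nlinarith
    nlinarith
  have haa : a + 1 ≤ (264 * Cb ^ n + 1) * P.K * P.Ω := by
    have h2 : (1 : ℝ) ≤ 1 * P.K * P.Ω := by nlinarith
    nlinarith
  -- `2^{2n+25} + 2^{n+1} + 2 ≤ 2^{2n+26}`
  have hpow : (2 : ℝ) ^ (2 * n + 25) + (2 ^ (n + 1) + 1) + 1 ≤ 2 ^ (2 * n + 26) := by
    have h1 : (2 : ℝ) ^ (n + 1) ≤ 2 ^ (2 * n + 24) := pow_le_pow_right₀ (by norm_num) (by omega)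
    have h2 : (2 : ℝ) ≤ 2 ^ (2 * n + 24) := by
      calc (2 : ℝ) = 2 ^ 1 := by norm_num
        _ ≤ 2 ^ (2 * n + 24) := pow_le_pow_right₀ (by norm_num) (by omega)
    have e1 : (2 : ℝ) ^ (2 * n + 25) = 2 * 2 ^ (2 * n + 24) := by ring
    have e2 : (2 : ℝ) ^ (2 * n + 26) = 4 * 2 ^ (2 * n + 24) := by ring
    linarith
  have hKΩ : 0 ≤ P.K * P.Ω := by positivity
  calc max (max (⌈a⌉₊ : ℝ) ((2 : ℝ) ^ (n + 25) * P.Nq)) (⌈2 * P.Amax⌉₊ : ℝ)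
      ≤ (⌈a⌉₊ : ℝ) + (2 : ℝ) ^ (n + 25) * P.Nq + (⌈2 * P.Amax⌉₊ : ℝ) := by
        have h0a : 0 ≤ (⌈a⌉₊ : ℝ) := by positivity
        have h0b : 0 ≤ (2 : ℝ) ^ (n + 25) * P.Nq := by positivity
        have h0c : 0 ≤ (⌈2 * P.Amax⌉₊ : ℝ) := by positivity
        refine max_le (max_le ?_ ?_) ?_ <;> linarith
    _ ≤ (264 * Cb ^ n + 1) * P.K * P.Ω + 2 ^ (2 * n + 25) * P.K * P.Ω + (2 ^ (n + 1) + 1) * P.K * P.Ω := by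
        linarith
    _ = (264 * Cb ^ n + (2 ^ (2 * n + 25) + (2 ^ (n + 1) + 1) + 1)) * (P.K * P.Ω) := by ring
    _ ≤ (264 * Cb ^ n + 2 ^ (2 * n + 26)) * (P.K * P.Ω) := by
        apply mul_le_mul_of_nonneg_right _ hKΩ
        linarith
    _ = (264 * Cb ^ n + 2 ^ (2 * n + 26)) * P.K * P.Ω := by ring

end PadicG3Par

end Summit.ABC.StewartYu

end
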